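import Summits.CriticalPhenomena.PercolationContinuityZ3.Theorems.PercNearOneGluingNoHeavyQuantGatedSliceMixLawRegimeBTopBelowKink
import Summits.CriticalPhenomena.PercolationContinuityZ3.Theorems.PercNearOneGluingNoHeavyQuantGatedSliceMixLawRegimeBTopBelowKinkB
import Summits.CriticalPhenomena.PercolationContinuityZ3.Theorems.PercNearOneGluingNoHeavyQuantGatedSliceMixLawKinkRatioHard
import Summits.CriticalPhenomena.PercolationContinuityZ3.Theorems.PercNearOneGluingNoHeavyQuantGatedSliceMixLawRegimeBCellBM
import Summits.CriticalPhenomena.PercolationContinuityZ3.Theorems.PercNearOneGluingNoHeavyQuantGatedSliceMixLawBTwinHolds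
import Summits.CriticalPhenomena.PercolationContinuityZ3.Theorems.PercNearOneGluingNoHeavyQuantGatedSliceMixLawA5Holds
import HarnessLib

/-!
# QUANT lane R8, T-DEC, leg (III), blob case — `LawDec.MixLawCellBTopBelow` HOLDS (`mixLawCellBTopBelow_holds`), hence
# `LawDec.MixLawRegimeB` HOLDS (`mixLawRegimeB_holds`, with arm-3 g120's `mixLawCellBTwin_holds`), and `GatedSliceMixLaw'` hangs on
# arm-1's three Q-cells alone (`gatedSliceMixLaw'_of_Qcells`)

builds on p205010 (kernel theorem, internal audit signed; external expert review pending)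

Support file (`--supports stmt-CriticalPhenomena-4575`), QUANT lane census seat (design 2, gen 61), rung R8 of
`run/shared/lean/prim/quant/LADDER.md`; memo `run/shared/lean/prim/quant/prim-quant-census-2-g61/REGIME-B-TOP-G61.md`.
Theorems only, standard axioms, no sorries, no definitions.

`MixLawCellBTopBelow` (`h < k₂ ≤ j` both mids, the shifted low `ℓ = k₁ + a` a `t`-low, the top saturated; `…RegimeBCells`) is one of the
two leaves of `MixLawRegimeB` (`mixLawRegimeB_of_leaves`, `…RegimeBCellBM`).  This file assembles it from the four exact-kink routes of
`…RegimeBTopBelowKink` / `…RegimeBTopBelowKinkB` — all resting on the pooled inequality (`…Pooled`) and the kink-ratio lemma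
(`usage_kink_le`, `…KinkRatio`; on the hard sub-cell `usage_kink_le_hard`, `…KinkRatioHard`, a 45-term certificate):
R1 (`k₁` dear at the top), R2 (`k₁` cheap, fitting into the top), R3 (`k₁` cheap, over-filling it), B (top filled only with `k₁`'s help).
R3 and B send `k₁` into `W`'s mid and need `t < k₁ + h` — which `weakMid_cheapTop_compat` derives for a cheap `k₁` from `W_h ∉ D`,
`y ≤ g`, `y·k₂ ≤ S`, `t ≤ 2S`, `h < k₂` (else `y > 1`).  So nothing is left: the cell is a theorem.

* `LawDec.weakMid_cheapTop_compat` — the compatibility lemma.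
* `LawDec.mixLawCellBTopBelow_holds : MixLawCellBTopBelow`.
* `LawDec.mixLawRegimeB_holds : MixLawRegimeB` — `mixLawRegimeB_of_leaves` (`…RegimeBCellBM`: lead g32's `mixLawRegimeB_of_cells`, cell B-G
  `gatedSliceMixLaw_regimeBG`, my `k₂ = h` / `k₂ < h` mixtures, the P-cells of arm-2 g36 / arm-3 g116, arm-1 g41's B-L top-mid) fed with
  `mixLawCellBTopBelow_holds` and arm-3 g120's `mixLawCellBTwin_holds` (`…BTwinHolds`).  REGIME B OF `GatedSliceMixLaw'` IS A THEOREM.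
* `LawDec.gatedSliceMixLaw'_of_Qcells : MixLawCellQ4 → MixLawCellQH → MixLawCellQK → GatedSliceMixLaw'` — arm-3 g116's
  `gatedSliceMixLaw'_of_QcellsB` with `MixLawRegimeB` discharged; the node now hangs on arm-1's Q-cells only.

[this work].  The gluing rows served [cite: KozmaNitzan2024, Conjecture 3 (p. 15)]; product measure [cite: Grimmett1999, §1.3 p. 10].
-/

noncomputable section

namespace Summit.CriticalPhenomena.PercolationContinuityZ3.Theorems

namespace Quant

open Finset

/-- the two-point law `{lo, hi; g}` (as in `…QuantLawDEC`) -/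
local notation3 "TP[" lo ", " hi ", " g ", " h "]" =>
  (g : ℝ) * (if (h : ℕ) = (hi : ℕ) then (1 : ℝ) else 0) + (1 - (g : ℝ)) * (if (h : ℕ) = (lo : ℕ) then (1 : ℝ) else 0)

namespace LawDec

/-- **THE SLIVER IS EMPTY**: in the cell, `k₁` cheap at the top `k₂` is always compatible with `W`'s mid `h` (`t < k₁ + h`).  From
`k₁ + h ≤ t ≤ 2k₁ + y(k₂ − k₁)`: `h ≤ (1−y)k₁ + yk₂`; from `W_h ∉ D` (its giant does not cover its zero) and `y ≤ g`: `h > S(2−y) ≥ yk₂(2−y)`,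
whence `yk₂ < k₁`; from `t ≤ 2S`: `y(k₁+h) > 2k₁`; with `h < k₂` these force `y > 1`. [this work] -/
theorem weakMid_cheapTop_compat (y S g k1 h k2 t : ℝ) (hy0 : 0 < y) (hy1 : y < 1) (hyg : y ≤ g) (hS0 : 0 ≤ S)
    (hyk₂ : y * k2 ≤ S) (hhk₂ : h < k2) (ht2S : t ≤ 2 * S) (hcheap : t - 2 * k1 ≤ y * (k2 - k1))
    (he : S * g * (1 - y) < y * (h - S)) : t < k1 + h := by
  by_contra hinc
  push Not at hinc
  have h1y : 0 < 1 - y := by linarith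
  have h1 : h ≤ (1 - y) * k1 + y * k2 := by linarith
  have h2 : S * y * (1 - y) ≤ S * g * (1 - y) := by
    have := mul_le_mul_of_nonneg_left hyg (mul_nonneg hS0 h1y.le); nlinarith
  have h3 : y * (S * (2 - y)) < y * h := by nlinarith
  have h4 : S * (2 - y) < h := lt_of_mul_lt_mul_left h3 hy0.le
  have h5 : (1 - y) * (y * k2) < (1 - y) * k1 := by nlinarith
  have h6 : y * k2 < k1 := lt_of_mul_lt_mul_left h5 h1y.le
  have h7 : (k1 + h) * (2 - y) < 2 * h := by nlinarith
  nlinarith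

set_option maxHeartbeats 800000 in
/-- **`MixLawCellBTopBelow` HOLDS.**  Routes: top saturated by `ℓ`, `k₁` dear at the top → `…_topBelow_R1`; `k₁` cheap and fitting →
`…_R2`; `k₁` cheap and over-filling, or the top filled only with `k₁`'s help → `…_R3` / `…_B` with `Φ(k₁)` from `usage_kink_le` (`k₁`
light at `h` or `k₁ ≥ t − S`) or `usage_kink_le_hard` (`k₁` heavy at `h`, `k₁ < t − S`; its hypothesis `2(t−S) ≤ g(t−2k₁)` from
`2(k₁+a) < t`); the routes through `h` need `t < k₁ + h`, which is `weakMid_cheapTop_compat`. [this work] -/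
theorem mixLawCellBTopBelow_holds :
    MixLawCellBTopBelow := by
  intro y z g S lam a j M h k₁ k₂ hy0 hy1 hz0 hz1 hg1 hyg ha hjM hS0 hta hhj hhM hSh hW hk hk₂M hlam0 hlam1 hmean hk₁j hk₁low hlj hk₂aG
    ht2S hhaG hllow hk₂j hhk₂ hsat
  have h1z : 0 < 1 - z := by linarith
  have hg0 : 0 < g := by nlinarith
  have h1y : 0 < 1 - y := by linarith
  have hh0 : (0 : ℝ) < h := lt_trans hS0 hSh
  have hhmid : S + (a : ℝ) * g * (1 - z) ≤ 2 * (h : ℝ) := by linarith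
  have hyh : y * (h : ℝ) ≤ S := le_trans (mul_le_mul_of_nonneg_left (by exact_mod_cast hhM) hy0.le) hta
  have hyk₂ : y * (k₂ : ℝ) ≤ S := le_trans (mul_le_mul_of_nonneg_left (by exact_mod_cast hk₂M) hy0.le) hta
  -- g < 1: otherwise the giant of `W_h` covers its zero and `W_h` is DEC
  have hg1' : g < 1 := by
    by_contra hc
    have hgeq : g = 1 := le_antisymm hg1 (not_lt.1 hc)
    apply hW
    refine decAtT_weakMidLaw_of_giant y z g S a j M h hy0 hy1 hg0.le hg1 hS0.le hSh hhj hhM hhaG hhmid ?_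
    rw [hgeq, mul_one]
    rw [show (1 : ℝ) - S / h = ((h : ℝ) - S) / h by field_simp, show y / (1 - y) * (((h : ℝ) - S) / h) = y * ((h : ℝ) - S) / ((1 - y) * h) by
      field_simp, div_le_div_iff₀ (mul_pos h1y hh0) hh0]
    have hx := mul_nonneg hh0.le (sub_nonneg.2 hyh)
    linarith only [hx]
  have hk' : (k₁ : ℝ) ≤ k₂ := by exact_mod_cast hk
  have hSk₂ : S ≤ (k₂ : ℝ) := by
    have e : (k₂ : ℝ) - S = z * k₂ + (1 - z) * (1 - lam) * ((k₂ : ℝ) - k₁) := by rw [← hmean]; ring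
    have p1 : 0 ≤ (1 - z) * (1 - lam) * ((k₂ : ℝ) - k₁) := mul_nonneg (mul_nonneg h1z.le (by linarith)) (by linarith)
    have p2 : 0 ≤ z * (k₂ : ℝ) := mul_nonneg hz0 (by positivity)
    linarith only [e, p1, p2]
  have hk₂mid : S + (a : ℝ) * g * (1 - z) ≤ 2 * (k₂ : ℝ) := by linarith
  have hk₁S : (k₁ : ℝ) ≤ S := by linarith
  -- `2(t − S) ≤ g(t − 2k₁)`: the shifted copy is a `t`-low and `t − S = ag(1−z) ≤ ag`
  have hgmin : 2 * ((S + (a : ℝ) * g * (1 - z)) - S) ≤ g * ((S + (a : ℝ) * g * (1 - z)) - 2 * (k₁ : ℝ)) := by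
    have e : g * ((S + (a : ℝ) * g * (1 - z)) - 2 * (k₁ : ℝ)) - 2 * ((S + (a : ℝ) * g * (1 - z)) - S)
        = g * ((S + (a : ℝ) * g * (1 - z)) - 2 * ((k₁ + a : ℕ) : ℝ)) + 2 * (a : ℝ) * g * z := by push_cast; ring
    have p1 : 0 ≤ g * ((S + (a : ℝ) * g * (1 - z)) - 2 * ((k₁ + a : ℕ) : ℝ)) := mul_nonneg hg0.le (by linarith)
    have p2 : 0 ≤ 2 * (a : ℝ) * g * z := mul_nonneg (mul_nonneg (mul_nonneg (by norm_num) (Nat.cast_nonneg a)) hg0.le) hz0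
    linarith [e, p1, p2]
  -- `W_h ∉ D` ⟹ its giant does not cover its zero: `S g (1−y) < y (h − S)`
  have he : S * g * (1 - y) < y * ((h : ℝ) - S) := by
    by_contra hc
    push Not at hc
    apply hW
    refine decAtT_weakMidLaw_of_giant y z g S a j M h hy0 hy1 hg0.le hg1 hS0.le hSh hhj hhM hhaG hhmid ?_
    rw [show (1 : ℝ) - S / h = ((h : ℝ) - S) / h by field_simp, show y / (1 - y) * (((h : ℝ) - S) / h) = y * ((h : ℝ) - S) / ((1 - y) * h) by
      field_simp, show S / (h : ℝ) * g = S * g * (1 - y) / ((1 - y) * h) by field_simp, div_le_div_iff_of_pos_right (mul_pos h1y hh0)]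
    exact hc
  have hyg' : y ≤ g := le_trans hyg (by nlinarith [mul_nonneg hz0 hg0.le])
  have hcompat : (S + (a : ℝ) * g * (1 - z)) - 2 * (k₁ : ℝ) ≤ y * ((k₂ : ℝ) - k₁) → (S + (a : ℝ) * g * (1 - z)) < (k₁ : ℝ) + h :=
    fun hck => weakMid_cheapTop_compat y S g (k₁ : ℝ) (h : ℝ) (k₂ : ℝ) (S + (a : ℝ) * g * (1 - z)) hy0 hy1 hyg' hS0.le
      hyk₂ (by exact_mod_cast hhk₂) ht2S hck he
  -- Φ(k₁) for `k₁` light at `k₂` and compatible with `h`: the crude or the hard certificate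
  have hΦ : (S + (a : ℝ) * g * (1 - z)) - 2 * (k₁ : ℝ) ≤ y * ((k₂ : ℝ) - k₁) → (S + (a : ℝ) * g * (1 - z)) < (k₁ : ℝ) + h →
      (y / (1 - y) * ((h : ℝ) - S) - S * g) * usage y (S + (a : ℝ) * g * (1 - z)) j k₁ h
        ≤ S * (1 - g) * usage y (S + (a : ℝ) * g * (1 - z)) j k₁ k₂ := by
    intro hck hcomp1h
    by_cases hgood : (S + (a : ℝ) * g * (1 - z)) - S ≤ (k₁ : ℝ) ∨ (S + (a : ℝ) * g * (1 - z)) - 2 * (k₁ : ℝ) ≤ y * ((h : ℝ) - k₁)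
    · refine usage_kink_le y S g (S + (a : ℝ) * g * (1 - z)) j k₁ h k₂ hy0 hy1 hS0.le hg0.le hk₁low hcomp1h hhk₂ hk₂j hyk₂ ?_
      rcases hgood with h0 | hL
      · exact Or.inl h0
      · exact Or.inr ⟨hL, by linarith⟩
    · push Not at hgood
      exact usage_kink_le_hard y S g (S + (a : ℝ) * g * (1 - z)) j k₁ h k₂ hy0 hy1 hS0.le hk₁low hcomp1h hhk₂ hk₂j hyk₂
        hgood.2.le hck hgood.1.le hgmin
  by_cases hN : ((1 - z) * lam * (1 - g)) ≤ usage y (S + (a : ℝ) * g * (1 - z)) j (k₁ + a) k₂ * ((1 - z) * (1 - lam) * g)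
  · by_cases hck : (S + (a : ℝ) * g * (1 - z)) - 2 * (k₁ : ℝ) ≤ y * ((k₂ : ℝ) - k₁)
    · by_cases hfit : usage y (S + (a : ℝ) * g * (1 - z)) j k₁ k₂ * ((1 - z) * (1 - lam) * (1 - g)) ≤ ((1 - z) * lam * (1 - g))
      · exact gatedSliceMixLaw_regimeB_topBelow_R2 y z g S lam a j M h k₁ k₂ hy0 hy1 hz0 hz1 hg1' hyg hS0 hta hhj hhM hSh hk hk₂M hlam0 hlam1 hmean hk₁j hk₁low hllow hlj hk₂aG hhaG hk₂j hk₂mid hhk₂ hhmid hck hN hfit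
      · push Not at hfit
        have hcomp1h := hcompat hck
        exact gatedSliceMixLaw_regimeB_topBelow_R3 y z g S lam a j M h k₁ k₂ hy0 hy1 hz0 hz1 hg1' hyg hS0 hta hhj hhM hSh hk hk₂M hlam0 hlam1 hmean hk₁j hk₁low hllow hlj hk₂aG hhaG hk₂j hk₂mid hhk₂ hhmid hcomp1h hck hfit.le (hΦ hck hcomp1h)
    · push Not at hck
      exact gatedSliceMixLaw_regimeB_topBelow_R1 y z g S lam a j M h k₁ k₂ hy0 hy1 hz0 hz1 hg1' hyg hS0 hta hhj hhM hSh hk hk₂M hlam0 hlam1 hmean hk₁j hk₁low hllow hlj hk₂aG hhaG hk₂j hk₂mid hhk₂ hhmid hN hck.le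
  · push Not at hN
    rcases hsat with hN' | ⟨hck, hΔ⟩
    · exact absurd hN' (not_le.2 hN)
    have hcomp1h := hcompat hck
    exact gatedSliceMixLaw_regimeB_topBelow_B y z g S lam a j M h k₁ k₂ hy0 hy1 hz0 hz1 hg1' hyg hS0 hta hhj hhM hSh hk hk₂M hlam0 hlam1 hmean hk₁j hk₁low hllow hlj hk₂aG hhaG hk₂j hk₂mid hhk₂ hhmid hcomp1h hck hN.le hΔ (hΦ hck hcomp1h)

/-- **`MixLawRegimeB` HOLDS**: both leaves of `mixLawRegimeB_of_leaves` are theorems — `mixLawCellBTopBelow_holds` (this file) and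
`mixLawCellBTwin_holds` (arm-3 g120, `…BTwinHolds`). [this work] -/
theorem mixLawRegimeB_holds : MixLawRegimeB :=
  mixLawRegimeB_of_leaves mixLawCellBTopBelow_holds mixLawCellBTwin_holds

/-- **`GatedSliceMixLaw'` FROM ARM-1'S THREE Q-CELLS** (`gatedSliceMixLaw'_of_QcellsB` of `…A5Holds` with `MixLawRegimeB` discharged). [this work] -/
theorem gatedSliceMixLaw'_of_Qcells (hQ4 : MixLawCellQ4) (hQH : MixLawCellQH) (hQK : MixLawCellQK) : GatedSliceMixLaw' :=
  gatedSliceMixLaw'_of_QcellsB hQ4 hQH hQK mixLawRegimeB_holds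

end LawDec

end Quant

end Summit.CriticalPhenomena.PercolationContinuityZ3.Theorems
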